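import Mathlib.LinearAlgebra.BilinearForm.Orthogonal
import Literature.Geometry.Riemannian.OrthonormalFrameBounds
import Literature.Geometry.Lorentzian.CurvatureContinuity
import Literature.Geometry.Riemannian.WeylEnergy
import Literature.Geometry.Riemannian.RicciFlowScalarCurvatureProofs
import HarnessLib

/-!
# Uniform bounds for the curvature components on the orthonormal frames of a compact manifold,
# for metrics of finite regularity `C^n`, `n ≥ 2` (with the Weyl tensor)

Finite-regularity companion of `OrthonormalFrameBounds.lean` (which is stated for `C^∞` metrics,
through the `C^∞` continuity of curvature components `contMDiffOn_curvature_apply`). With the `C⁰`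
continuity of the curvature of a `C²` metric (`Lorentzian/CurvatureContinuity.lean`:
`continuousOn_curvatureForm_localFrame`, `continuousOn_gram_localFrame`; O'Neill 1983, Ch. 3,
Lemma 3.35 at regularity `C⁰`) the same compactness argument — frames near a point are bounded
coefficient arrays in a local frame, orthonormality is a closed condition, a continuous function
has a positive minimum on a compact set — gives, for a positive definite `C^n` metric `g`, `n ≥ 2`,
and any Levi-Civita connection `cov` of `g`, on ANY model with corners:

* `exists_pos_mul_norm_sq_le_val_cn` — uniform positive-definiteness `λ‖w‖² ≤ g_x(Σwᵢsᵢ, Σwᵢsᵢ)`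
  over a compact subset of the base set of a trivialization;
* `exists_nhds_pos_le_curvatureFunctional_of_two_le`, `exists_pos_le_curvatureFunctional_of_two_le`
  — a continuous functional of the curvature components `Rm_x(e_a,e_b,e_c,e_d)` of orthonormal
  frames (and of a compact parameter), positive at every orthonormal frame, is bounded below by a
  positive constant, near every point and on a compact manifold;
* **`exists_abs_curvatureForm_frame_le_of_two_le`** — on a compact manifold (possibly with
  boundary) with a positive definite `C^n` metric, `n ≥ 2`: `|Rm_x(e_a, e_b, e_c, e_d)| ≤ C` for ONE
  constant `C`, every point `x` and every `g_x`-orthonormal frame `e` (the functional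
  `1/(1 + Σ R²)`);
* **`exists_abs_ricci_frame_le_of_two_le`**, **`exists_abs_scalarCurvature_le_of_two_le`**,
  **`exists_abs_weylFrame_le_of_two_le`** — hence `|Ric(e_a, e_b)| ≤ C'`, `|S| ≤ C''` and the frame
  Weyl components (`WeylEnergy.lean`) `|W_{ijkl}(e)| ≤ C_W` on orthonormal bases.

This is the compactness half of the curvature decay of conformally compact metrics (Li–Qing–Shi
2017, Lemma 1.6; proof of Thm. 1.8, Step 1, pp. 12–13: "`|W|[g⁺](p) → 0` as `p → ∞`"): the
compactification `ḡ = ρ² g⁺` is a `C²` metric on the COMPACT manifold with boundary `X̄`, so its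
Weyl tensor is bounded on `ḡ`-orthonormal frames, and `|W[g⁺]|_{g⁺} = ρ²|W[ḡ]|_ḡ`.

## References

* B. O'Neill, *Semi-Riemannian geometry* (1983), Ch. 3, Lemma 3.35, Lemma 3.52, Def. 3.53.
  [ONeill1983]
* R. S. Hamilton, Comm. Anal. Geom. 5 (1997), §2.1, p. 8 (the compactness step). [Hamilton1997]
* G. Li, J. Qing, Y. Shi, Trans. Amer. Math. Soc. 369 (2017) 4385–4413 (arXiv:1410.6402),
  Lemma 1.6, proof of Thm. 1.8 (pp. 12–13). [LiQingShi2017]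
-/

noncomputable section

open Bundle Set Function Filter
open scoped Manifold ContDiff Topology BigOperators

namespace Literature.Geometry.Riemannian

open Lorentzian Lorentzian.PseudoRiemannianMetric

variable {E : Type*} [NormedAddCommGroup E] [NormedSpace ℝ E] {H : Type*} [TopologicalSpace H]
  {I : ModelWithCorners ℝ E H} {M : Type*} [TopologicalSpace M] [ChartedSpace H M]
  [IsManifold I ∞ M] {n : ℕ∞ω}
  {g : PseudoRiemannianMetric I n E (TangentSpace I : M → Type _)}
  {cov : CovariantDerivative I E (TangentSpace I : M → Type _)}

/-! ### Positive-definiteness in a local frame, any regularity -/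

section LocalFrame

variable (e₀ : Trivialization E (TotalSpace.proj : TangentBundle I M → M)) [MemTrivializationAtlas e₀]
  {κ : Type*} (bE : Module.Basis κ ℝ E)

/-- **Uniform positive-definiteness on a compact set, `C^n` metric.** For a positive definite
`C^n` metric `g` (any `n`) and a compact set `K` inside the base set of a trivialization, there is
`λ > 0` with `λ ‖w‖² ≤ g_x(Σ wᵢ sᵢ x, Σ wᵢ sᵢ x)` for all `x ∈ K` and all coefficient vectors `w`
(sup norm). The proof of `exists_pos_mul_norm_sq_le_val` with the `C⁰` Gram entries
`continuousOn_gram_localFrame`. [folklore] -/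
theorem exists_pos_mul_norm_sq_le_val_cn [Fintype κ] [T2Space M] (hg : g.IsRiemannian)
    {K : Set M} (hK : IsCompact K) (hKe : K ⊆ e₀.baseSet) :
    ∃ lam : ℝ, 0 < lam ∧ ∀ x ∈ K, ∀ w : κ → ℝ,
      lam * ‖w‖ ^ 2 ≤ g.val x (∑ i, w i • e₀.localFrame bE i x) (∑ i, w i • e₀.localFrame bE i x) := by
  classical
  -- the quadratic form in coordinates
  set Q : M × (κ → ℝ) → ℝ := fun p ↦
    g.val p.1 (∑ i, p.2 i • e₀.localFrame bE i p.1) (∑ i, p.2 i • e₀.localFrame bE i p.1) with hQ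
  have hQsum : ∀ p : M × (κ → ℝ), Q p =
      ∑ i, ∑ j, p.2 i * p.2 j * g.val p.1 (e₀.localFrame bE i p.1) (e₀.localFrame bE j p.1) :=
    fun p ↦ val_sum_smul_sum_smul g p.1 p.2 p.2 _ _
  have hQcont : ContinuousOn Q (e₀.baseSet ×ˢ univ) := by
    refine ContinuousOn.congr ?_ fun p _ ↦ hQsum p
    refine continuousOn_finsetSum _ fun i _ ↦ continuousOn_finsetSum _ fun j _ ↦ ?_
    exact (((continuous_apply i).comp continuous_snd).continuousOn.mul
      ((continuous_apply j).comp continuous_snd).continuousOn).mul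
      ((Lorentzian.continuousOn_gram_localFrame e₀ g bE i j).continuousOn.comp
        continuous_fst.continuousOn fun p hp ↦ hp.1)
  -- homogeneity
  have hQsmul : ∀ (x : M) (c : ℝ) (w : κ → ℝ), Q (x, c • w) = c ^ 2 * Q (x, w) := by
    intro x c w
    have : (∑ i, (c • w) i • e₀.localFrame bE i x) = c • ∑ i, w i • e₀.localFrame bE i x := by
      simp only [Pi.smul_apply, smul_eq_mul, Finset.smul_sum, smul_smul]
    simp only [hQ]
    rw [this]; simp only [map_smul, _root_.smul_apply, smul_eq_mul]; ring
  -- positivity on nonzero coefficient vectors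
  have hQpos : ∀ x ∈ e₀.baseSet, ∀ w : κ → ℝ, w ≠ 0 → 0 < Q (x, w) := by
    intro x hx w hw
    apply hg
    intro hzero
    apply hw
    have hli := (e₀.basisAt bE hx).linearIndependent
    rw [Fintype.linearIndependent_iff] at hli
    have hzero' : ∑ i, w i • (e₀.basisAt bE hx) i = 0 := by
      simpa only [e₀.localFrame_apply_of_mem_baseSet bE hx] using hzero
    funext i
    exact hli w hzero' i
  -- degenerate cases: no coordinates, or `K = ∅`
  by_cases hκ : IsEmpty κ
  · refine ⟨1, one_pos, fun x hx w ↦ ?_⟩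
    have hw : w = 0 := Subsingleton.elim _ _
    subst hw
    simp
  rw [not_isEmpty_iff] at hκ
  obtain ⟨i₀⟩ := hκ
  by_cases hKne : K.Nonempty
  swap
  · exact ⟨1, one_pos, fun x hx _ ↦ (hKne ⟨x, hx⟩).elim⟩
  obtain ⟨x₁, hx₁⟩ := hKne
  -- the compact set `K × sphere`
  set S : Set (M × (κ → ℝ)) := K ×ˢ Metric.sphere (0 : κ → ℝ) 1 with hS
  have hScomp : IsCompact S := hK.prod (isCompact_sphere 0 1)
  have hScont : ContinuousOn Q S := hQcont.mono (prod_mono hKe (subset_univ _))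
  have hSne : S.Nonempty := ⟨(x₁, Pi.single i₀ 1), hx₁, by simp [Pi.norm_single]⟩
  obtain ⟨p₀, hp₀, hmin⟩ := hScomp.exists_isMinOn hSne hScont
  have hw₀ : p₀.2 ≠ 0 := fun h0 ↦ by simpa [h0] using hp₀.2
  have hp₀pos : 0 < Q p₀ := hQpos p₀.1 (hKe hp₀.1) p₀.2 hw₀
  refine ⟨Q p₀, hp₀pos, fun x hx w ↦ ?_⟩
  by_cases hw : w = 0
  · subst hw
    simp
  · have hnorm : 0 < ‖w‖ := norm_pos_iff.mpr hw
    set w' : κ → ℝ := ‖w‖⁻¹ • w with hw'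
    have hw'S : (x, w') ∈ S := by
      refine ⟨hx, ?_⟩
      simp [hw', norm_smul, hnorm.ne']
    have hle : Q p₀ ≤ Q (x, w') := hmin hw'S
    have hQw' : Q (x, w') = (‖w‖⁻¹) ^ 2 * Q (x, w) := hQsmul x _ w
    rw [hQw'] at hle
    have := mul_le_mul_of_nonneg_right hle (sq_nonneg ‖w‖)
    calc Q p₀ * ‖w‖ ^ 2 ≤ (‖w‖⁻¹) ^ 2 * Q (x, w) * ‖w‖ ^ 2 := this
      _ = Q (x, w) := by field_simp

end LocalFrame

/-! ### Uniform positivity of continuous curvature functionals, `C^n` metric, `n ≥ 2` -/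

section Functional

variable [FiniteDimensional ℝ E] [CompleteSpace E] [T2Space M]
  {ι : Type*} [Fintype ι] [DecidableEq ι] {Y : Type*} [TopologicalSpace Y] [T2Space Y]

/-- **Local uniform positivity of a continuous curvature functional, `C^n` metric, `n ≥ 2`.**
Let `g` be a positive definite `C^n` metric, `n ≥ 2`, with a Levi-Civita connection `cov`, `K` a
compact parameter set and `F(R, y)` a continuous function of an array `R : ι⁴ → ℝ` and of `y ∈ K`.
If `F` is positive on the curvature components `R_{abcd} = Rm_x(e_a, e_b, e_c, e_d)` of every
`g`-orthonormal `ι`-frame `e` for all `y ∈ K`, then near every point it is bounded below by a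
positive constant. The proof of `exists_nhds_pos_le_curvatureFunctional` with the `C⁰` continuity
of the curvature components of a `C²` metric (`Lorentzian.continuousOn_curvatureForm_localFrame`).
[folklore] -/
theorem exists_nhds_pos_le_curvatureFunctional_of_two_le [LocallyCompactSpace M] [Fact (1 ≤ n)]
    (hn : 2 ≤ n) (hg : g.IsRiemannian)
    (hcov : g.IsLeviCivita cov) {K : Set Y} (hK : IsCompact K)
    {F : (ι → ι → ι → ι → ℝ) → Y → ℝ} (hF : ContinuousOn (uncurry F) (univ ×ˢ K))
    (hpos : ∀ (x : M) (e : ι → TangentSpace I x), g.IsOrthonormalFrame x e → ∀ y ∈ K,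
      0 < F (fun a b c d ↦ g.curvatureForm cov x (e a) (e b) (e c) (e d)) y)
    (x₀ : M) :
    ∃ U ∈ 𝓝 x₀, ∃ m : ℝ, 0 < m ∧ ∀ x ∈ U, ∀ (e : ι → TangentSpace I x),
      g.IsOrthonormalFrame x e → ∀ y ∈ K,
        m ≤ F (fun a b c d ↦ g.curvatureForm cov x (e a) (e b) (e c) (e d)) y := by
  classical
  have h1 : cov.IsLocallyContMDiff 1 := hcov.isLocallyContMDiff_one hn
  have h0 : cov.IsLocallyContMDiff 0 := hcov.isLocallyContMDiff_zero hn
  -- the trivialization and local frame at `x₀`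
  set e₀ := trivializationAt E (TangentSpace I : M → Type _) x₀ with he₀
  set bE := Module.finBasis ℝ E with hbE
  set s : Fin (Module.finrank ℝ E) → Π x : M, TangentSpace I x := e₀.localFrame bE with hsdef
  have hx₀ : x₀ ∈ e₀.baseSet := FiberBundle.mem_baseSet_trivializationAt E _ x₀
  -- a compact neighbourhood of `x₀` inside the base set
  obtain ⟨Kx, hKx_nhds, hKx_sub, hKx_comp⟩ := local_compact_nhds (e₀.open_baseSet.mem_nhds hx₀)
  -- uniform positive-definiteness of `g` in the frame over `Kx`
  obtain ⟨lam, hlam, hlamle⟩ := exists_pos_mul_norm_sq_le_val_cn e₀ bE hg hKx_comp hKx_sub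
  have hG : ∀ i j, ContinuousOn (fun x ↦ g.val x (s i x) (s j x)) e₀.baseSet := fun i j ↦
    (Lorentzian.continuousOn_gram_localFrame e₀ g bE i j).continuousOn
  have hρ : ∀ i j k l, ContinuousOn
      (fun x ↦ g.curvatureForm cov x (s i x) (s j x) (s k x) (s l x)) e₀.baseSet := fun i j k l ↦
    (Lorentzian.continuousOn_curvatureForm_localFrame e₀ g h1 h0 bE i j k l).continuousOn
  -- the compact parameter domain: point, bounded coefficient array, parameter
  set R : ℝ := max 1 lam⁻¹ with hR
  have hR0 : 0 ≤ R := zero_le_one.trans (le_max_left _ _)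
  set D₀ : Set (M × (ι → Fin (Module.finrank ℝ E) → ℝ) × Y) :=
    Kx ×ˢ (Metric.closedBall 0 R ×ˢ K) with hD₀
  have hD₀comp : IsCompact D₀ := hKx_comp.prod ((isCompact_closedBall 0 R).prod hK)
  have hD₀closed : IsClosed D₀ := hD₀comp.isClosed
  have hD₀base : ∀ p ∈ D₀, p.1 ∈ e₀.baseSet := fun p hp ↦ hKx_sub hp.1
  -- continuity of the coefficient projections
  have hCcont : ∀ (a : ι) (i : Fin (Module.finrank ℝ E)),
      Continuous fun p : M × (ι → Fin (Module.finrank ℝ E) → ℝ) × Y ↦ p.2.1 a i := fun a i ↦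
    (continuous_apply i).comp ((continuous_apply a).comp (continuous_fst.comp continuous_snd))
  -- the Gram map `(a, b) ↦ g_x(e_a, e_b)` in coordinates
  set Gr : M × (ι → Fin (Module.finrank ℝ E) → ℝ) × Y → (ι → ι → ℝ) := fun p a b ↦
    ∑ i, ∑ j, p.2.1 a i * p.2.1 b j * g.val p.1 (s i p.1) (s j p.1) with hGr
  have hGrcont : ContinuousOn Gr D₀ := by
    refine continuousOn_pi.2 fun a ↦ continuousOn_pi.2 fun b ↦ ?_
    refine continuousOn_finsetSum _ fun i _ ↦ continuousOn_finsetSum _ fun j _ ↦ ?_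
    exact (((hCcont a i).continuousOn.mul (hCcont b j).continuousOn)).mul
      ((hG i j).comp continuous_fst.continuousOn hD₀base)
  set D : Set (M × (ι → Fin (Module.finrank ℝ E) → ℝ) × Y) :=
    D₀ ∩ Gr ⁻¹' {fun a b ↦ if a = b then (1 : ℝ) else 0} with hD
  have hDcomp : IsCompact D :=
    hD₀comp.of_isClosed_subset
      (hGrcont.preimage_isClosed_of_isClosed hD₀closed isClosed_singleton) inter_subset_left
  -- the functional in coordinates
  set Φ : M × (ι → Fin (Module.finrank ℝ E) → ℝ) × Y → ℝ := fun p ↦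
    F (fun a b c d ↦ ∑ i, ∑ j, ∑ k, ∑ l, p.2.1 a i * p.2.1 b j * p.2.1 c k * p.2.1 d l *
      g.curvatureForm cov p.1 (s i p.1) (s j p.1) (s k p.1) (s l p.1)) p.2.2 with hΦ
  have hΦcont : ContinuousOn Φ D₀ := by
    have hinner : ContinuousOn (fun p : M × (ι → Fin (Module.finrank ℝ E) → ℝ) × Y ↦
        ((fun a b c d ↦ ∑ i, ∑ j, ∑ k, ∑ l, p.2.1 a i * p.2.1 b j * p.2.1 c k * p.2.1 d l *
          g.curvatureForm cov p.1 (s i p.1) (s j p.1) (s k p.1) (s l p.1) :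
            ι → ι → ι → ι → ℝ), p.2.2)) D₀ := by
      refine ContinuousOn.prodMk ?_ (continuous_snd.comp continuous_snd).continuousOn
      refine continuousOn_pi.2 fun a ↦ continuousOn_pi.2 fun b ↦ continuousOn_pi.2 fun c ↦
        continuousOn_pi.2 fun d ↦ ?_
      refine continuousOn_finsetSum _ fun i _ ↦ continuousOn_finsetSum _ fun j _ ↦
        continuousOn_finsetSum _ fun k _ ↦ continuousOn_finsetSum _ fun l _ ↦ ?_
      exact ((((hCcont a i).continuousOn.mul (hCcont b j).continuousOn).mul
        (hCcont c k).continuousOn).mul (hCcont d l).continuousOn).mul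
        ((hρ i j k l).comp continuous_fst.continuousOn hD₀base)
    exact hF.comp hinner fun p hp ↦ ⟨mem_univ _, hp.2.2⟩
  -- points of `D` are orthonormal frames
  have hframe : ∀ p ∈ D, g.IsOrthonormalFrame p.1 (fun a ↦ ∑ i, p.2.1 a i • s i p.1) := by
    intro p hp
    have hGrp : Gr p = fun a b ↦ if a = b then (1 : ℝ) else 0 := hp.2
    have hval : ∀ a b, g.val p.1 (∑ i, p.2.1 a i • s i p.1) (∑ j, p.2.1 b j • s j p.1) =
        if a = b then (1 : ℝ) else 0 := fun a b ↦ by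
      rw [val_sum_smul_sum_smul g]
      exact congrFun (congrFun hGrp a) b
    exact ⟨fun a ↦ by simpa using hval a a, fun a b hab ↦ by simpa [hab] using hval a b⟩
  have hΦpos : ∀ p ∈ D, 0 < Φ p := by
    intro p hp
    have := hpos p.1 _ (hframe p hp) p.2.2 hp.1.2.2
    simpa only [hΦ, curvatureForm_sum_smul] using this
  -- a positive lower bound on `D`
  obtain ⟨m, hm, hmle⟩ : ∃ m : ℝ, 0 < m ∧ ∀ p ∈ D, m ≤ Φ p := by
    by_cases hDne : D.Nonempty
    · obtain ⟨p₀, hp₀, hmin⟩ := hDcomp.exists_isMinOn hDne (hΦcont.mono inter_subset_left)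
      exact ⟨Φ p₀, hΦpos p₀ hp₀, fun p hp ↦ hmin hp⟩
    · exact ⟨1, one_pos, fun p hp ↦ (hDne ⟨p, hp⟩).elim⟩
  refine ⟨Kx, hKx_nhds, m, hm, fun x hx e he y hy ↦ ?_⟩
  have hxe : x ∈ e₀.baseSet := hKx_sub hx
  -- the coefficients of `e` in the local frame
  set C : ι → Fin (Module.finrank ℝ E) → ℝ := fun a i ↦ (e₀.basisAt bE hxe).repr (e a) i with hC
  have heC : ∀ a, (∑ i, C a i • s i x) = e a := fun a ↦ by
    simp only [hC, hsdef, e₀.localFrame_apply_of_mem_baseSet bE hxe]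
    exact (e₀.basisAt bE hxe).sum_repr (e a)
  -- `(x, C, y) ∈ D`
  have hCnorm : ‖C‖ ≤ R := by
    refine (pi_norm_le_iff_of_nonneg hR0).2 fun a ↦ ?_
    have h1' : lam * ‖C a‖ ^ 2 ≤ 1 := by
      have := hlamle x hx (C a); rwa [heC a, he.1 a] at this
    by_cases hle1 : ‖C a‖ ≤ 1
    · exact hle1.trans (le_max_left _ _)
    · have hgt : 1 < ‖C a‖ := lt_of_not_ge hle1
      have hsq : ‖C a‖ ≤ ‖C a‖ ^ 2 := by nlinarith
      have h2 : ‖C a‖ ^ 2 ≤ lam⁻¹ := by rwa [← one_div, le_div_iff₀' hlam]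
      exact (hsq.trans h2).trans (le_max_right _ _)
  have hmem : (x, C, y) ∈ D := by
    refine ⟨⟨hx, mem_closedBall_zero_iff.2 hCnorm, hy⟩, ?_⟩
    show Gr (x, C, y) = fun a b ↦ if a = b then (1 : ℝ) else 0
    funext a b
    simp only [hGr]
    rw [← val_sum_smul_sum_smul g, heC a, heC b]
    by_cases hab : a = b
    · subst hab; simp [he.1 a]
    · simp [hab, he.2 a b hab]
  have key := hmle _ hmem
  have hval : Φ (x, C, y) = F (fun a b c d ↦ g.curvatureForm cov x (e a) (e b) (e c) (e d)) y := by
    simp only [hΦ]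
    congr 1
    funext a b c d
    rw [← heC a, ← heC b, ← heC c, ← heC d, curvatureForm_sum_smul]
  rwa [hval] at key

/-- **Uniform positivity of a continuous curvature functional on a compact manifold, `C^n`
metric, `n ≥ 2`** (finite subcover of `exists_nhds_pos_le_curvatureFunctional_of_two_le`).
[folklore] -/
theorem exists_pos_le_curvatureFunctional_of_two_le [CompactSpace M] [LocallyCompactSpace M]
    [Fact (1 ≤ n)] (hn : 2 ≤ n)
    (hg : g.IsRiemannian) (hcov : g.IsLeviCivita cov) {K : Set Y} (hK : IsCompact K)
    {F : (ι → ι → ι → ι → ℝ) → Y → ℝ} (hF : ContinuousOn (uncurry F) (univ ×ˢ K))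
    (hpos : ∀ (x : M) (e : ι → TangentSpace I x), g.IsOrthonormalFrame x e → ∀ y ∈ K,
      0 < F (fun a b c d ↦ g.curvatureForm cov x (e a) (e b) (e c) (e d)) y) :
    ∃ m : ℝ, 0 < m ∧ ∀ (x : M) (e : ι → TangentSpace I x), g.IsOrthonormalFrame x e →
      ∀ y ∈ K, m ≤ F (fun a b c d ↦ g.curvatureForm cov x (e a) (e b) (e c) (e d)) y := by
  choose U hU m hm hle using
    fun x₀ ↦ exists_nhds_pos_le_curvatureFunctional_of_two_le hn hg hcov hK hF hpos x₀
  obtain ⟨t, -, ht⟩ := isCompact_univ.elim_nhds_subcover U fun x _ ↦ hU x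
  have hcover : ∀ x : M, ∃ x₀ ∈ t, x ∈ U x₀ := fun x ↦ by
    simpa only [mem_iUnion, exists_prop] using ht (mem_univ x)
  by_cases htne : t.Nonempty
  · refine ⟨t.inf' htne m, (Finset.lt_inf'_iff _).2 fun x _ ↦ hm x, fun x e he y hy ↦ ?_⟩
    obtain ⟨x₀, hx₀t, hxU⟩ := hcover x
    exact (Finset.inf'_le m hx₀t).trans (hle x₀ x hxU e he y hy)
  · refine ⟨1, one_pos, fun x e he y hy ↦ ?_⟩
    obtain ⟨x₀, hx₀t, -⟩ := hcover x
    exact (htne ⟨x₀, hx₀t⟩).elim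

/-! ### Bounded curvature, Ricci, scalar curvature and Weyl components on orthonormal frames -/

/-- **The curvature components on orthonormal frames are uniformly bounded on a compact manifold,
`C^n` metric, `n ≥ 2`** (possibly with boundary): `|Rm_x(e_a, e_b, e_c, e_d)| ≤ C` for one
constant `C`, all `x` and all `g_x`-orthonormal frames `e : ι → T_xM` (the positive continuous
functional `1/(1 + Σ_{abcd} R_{abcd}²)` is bounded below; O'Neill 1983, Ch. 3, Lemma 3.35: `Rm`
is a continuous tensor field, and the orthonormal frame bundle over a compact base is compact).
[cite: ONeill1983, Ch. 3, Lemma 3.35] -/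
theorem exists_abs_curvatureForm_frame_le_of_two_le [CompactSpace M] [LocallyCompactSpace M]
    [Fact (1 ≤ n)] (hn : 2 ≤ n) (hg : g.IsRiemannian) (hcov : g.IsLeviCivita cov) :
    ∃ C : ℝ, 0 ≤ C ∧ ∀ (x : M) (e : ι → TangentSpace I x), g.IsOrthonormalFrame x e →
      ∀ a b c d, |g.curvatureForm cov x (e a) (e b) (e c) (e d)| ≤ C := by
  classical
  -- the functional `1/(1 + Σ R²)` on arrays, with a trivial parameter
  set F : (ι → ι → ι → ι → ℝ) → Unit → ℝ :=
    fun R _ ↦ 1 / (1 + ∑ a, ∑ b, ∑ c, ∑ d, R a b c d ^ 2) with hF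
  have hsum_nonneg : ∀ R : ι → ι → ι → ι → ℝ, 0 ≤ ∑ a, ∑ b, ∑ c, ∑ d, R a b c d ^ 2 := fun R ↦
    Finset.sum_nonneg fun _ _ ↦ Finset.sum_nonneg fun _ _ ↦ Finset.sum_nonneg fun _ _ ↦
      Finset.sum_nonneg fun _ _ ↦ sq_nonneg _
  have hden : ∀ R : ι → ι → ι → ι → ℝ, 0 < 1 + ∑ a, ∑ b, ∑ c, ∑ d, R a b c d ^ 2 := fun R ↦ by
    linarith [hsum_nonneg R]
  have hFpos : ∀ R u, 0 < F R u := fun R u ↦ by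
    simp only [hF]
    exact one_div_pos.2 (hden R)
  have hScont : Continuous fun R : ι → ι → ι → ι → ℝ ↦ ∑ a, ∑ b, ∑ c, ∑ d, R a b c d ^ 2 := by
    refine continuous_finsetSum _ fun a _ ↦ continuous_finsetSum _ fun b _ ↦
      continuous_finsetSum _ fun c _ ↦ continuous_finsetSum _ fun d _ ↦ ?_
    exact ((continuous_apply d).comp ((continuous_apply c).comp ((continuous_apply b).comp
      (continuous_apply a)))).pow 2
  have hFcont : ContinuousOn (uncurry F) (univ ×ˢ (univ : Set Unit)) := by
    have hc : Continuous (uncurry F) := by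
      have : uncurry F = fun p ↦ 1 / (1 + ∑ a, ∑ b, ∑ c, ∑ d, p.1 a b c d ^ 2) := by
        funext p; rfl
      rw [this]
      exact continuous_const.div (continuous_const.add (hScont.comp continuous_fst))
        fun p ↦ (hden p.1).ne'
    exact hc.continuousOn
  obtain ⟨m, hm, hmle⟩ := exists_pos_le_curvatureFunctional_of_two_le (ι := ι) hn hg hcov
    (isCompact_univ : IsCompact (univ : Set Unit)) hFcont
    (fun x e he y _ ↦ hFpos _ y)
  refine ⟨Real.sqrt (1 / m), Real.sqrt_nonneg _, fun x e he a b c d ↦ ?_⟩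
  set R : ι → ι → ι → ι → ℝ := fun a b c d ↦ g.curvatureForm cov x (e a) (e b) (e c) (e d) with hR
  have key : m ≤ 1 / (1 + ∑ a, ∑ b, ∑ c, ∑ d, R a b c d ^ 2) := hmle x e he () (mem_univ _)
  -- `1 + Σ R² ≤ 1/m`, so each `R² ≤ 1/m`
  have h1 : 1 + ∑ a, ∑ b, ∑ c, ∑ d, R a b c d ^ 2 ≤ 1 / m := by
    rw [le_div_iff₀ hm]
    have := (le_div_iff₀ (hden R)).1 key
    linarith
  have hterm : R a b c d ^ 2 ≤ ∑ a, ∑ b, ∑ c, ∑ d, R a b c d ^ 2 := by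
    have h4 : R a b c d ^ 2 ≤ ∑ d', R a b c d' ^ 2 :=
      Finset.single_le_sum (f := fun d' ↦ R a b c d' ^ 2) (fun _ _ ↦ sq_nonneg _) (Finset.mem_univ d)
    have h3 : ∑ d', R a b c d' ^ 2 ≤ ∑ c', ∑ d', R a b c' d' ^ 2 :=
      Finset.single_le_sum (f := fun c' ↦ ∑ d', R a b c' d' ^ 2)
        (fun _ _ ↦ Finset.sum_nonneg fun _ _ ↦ sq_nonneg _) (Finset.mem_univ c)
    have h2 : ∑ c', ∑ d', R a b c' d' ^ 2 ≤ ∑ b', ∑ c', ∑ d', R a b' c' d' ^ 2 :=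
      Finset.single_le_sum (f := fun b' ↦ ∑ c', ∑ d', R a b' c' d' ^ 2)
        (fun _ _ ↦ Finset.sum_nonneg fun _ _ ↦ Finset.sum_nonneg fun _ _ ↦ sq_nonneg _)
        (Finset.mem_univ b)
    have h1' : ∑ b', ∑ c', ∑ d', R a b' c' d' ^ 2 ≤ ∑ a', ∑ b', ∑ c', ∑ d', R a' b' c' d' ^ 2 :=
      Finset.single_le_sum (f := fun a' ↦ ∑ b', ∑ c', ∑ d', R a' b' c' d' ^ 2)
        (fun _ _ ↦ Finset.sum_nonneg fun _ _ ↦ Finset.sum_nonneg fun _ _ ↦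
          Finset.sum_nonneg fun _ _ ↦ sq_nonneg _) (Finset.mem_univ a)
    exact ((h4.trans h3).trans h2).trans h1'
  have hsq : R a b c d ^ 2 ≤ 1 / m := by linarith
  have habs : |R a b c d| ≤ Real.sqrt (1 / m) := by
    rw [← Real.sqrt_sq_eq_abs]
    exact Real.sqrt_le_sqrt hsq
  exact habs

/-- **The Ricci components on orthonormal bases are uniformly bounded on a compact manifold,
`C^n` metric, `n ≥ 2`**: `|Ric_x(e_a, e_b)| ≤ C` for all `x` and all `g_x`-orthonormal frames of
cardinality `dim E` (`Ric(e_a,e_b) = Σᵢ Rm(eᵢ,e_a,e_b,eᵢ)`, O'Neill 1983, Lemma 3.52).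
[cite: ONeill1983, Ch. 3, Lemma 3.52] -/
theorem exists_abs_ricci_frame_le_of_two_le [CompactSpace M] [LocallyCompactSpace M]
    [Fact (1 ≤ n)] (hn : 2 ≤ n) (hg : g.IsRiemannian) (hcov : g.IsLeviCivita cov)
    (hι : Fintype.card ι = Module.finrank ℝ E) :
    ∃ C : ℝ, 0 ≤ C ∧ ∀ (x : M) (e : ι → TangentSpace I x), g.IsOrthonormalFrame x e →
      ∀ a b, |cov.ricci x (e a) (e b)| ≤ C := by
  obtain ⟨C, hC0, hC⟩ := exists_abs_curvatureForm_frame_le_of_two_le (ι := ι) hn hg hcov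
  refine ⟨Fintype.card ι * C, by positivity, fun x e he a b ↦ ?_⟩
  -- `e` is a basis and `Ric = Σ Rm`
  have hli : LinearIndependent ℝ e :=
    LinearMap.BilinForm.linearIndependent_of_iIsOrtho (B := g.toBilinForm x)
      (LinearMap.BilinForm.iIsOrtho_def.2 fun i j hij ↦ by simpa using he.2 i j hij)
      fun i ↦ by simp [he.1 i]
  haveI : FiniteDimensional ℝ (TangentSpace I x) := ‹FiniteDimensional ℝ E›
  set β : Module.Basis ι ℝ (TangentSpace I x) := Module.Basis.mk hli
    (hli.span_eq_top_of_card_eq_finrank' (hι.trans rfl)).ge with hβ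
  have hβe : ⇑β = e := Module.Basis.coe_mk _ _
  have hRic := g.ricci_eq_sum_of_isOrthonormalFrame β (by rw [hβe]; exact he) cov (e a) (e b)
  rw [hβe] at hRic
  rw [hRic]
  calc |∑ i, g.curvatureForm cov x (e i) (e a) (e b) (e i)|
      ≤ ∑ i, |g.curvatureForm cov x (e i) (e a) (e b) (e i)| := Finset.abs_sum_le_sum_abs _ _
    _ ≤ ∑ _i : ι, C := Finset.sum_le_sum fun i _ ↦ hC x e he i a b i
    _ = Fintype.card ι * C := by simp [Finset.sum_const, Finset.card_univ]

/-- **The scalar curvature of a `C^n` metric, `n ≥ 2`, is bounded on a compact manifold**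
(`S = Σₐ Ric(e_a, e_a)` in an orthonormal basis, which exists at every point of a positive
definite metric; O'Neill 1983, Def. 3.53). [cite: ONeill1983, Ch. 3, Def. 3.53] -/
theorem exists_abs_scalarCurvature_le_of_two_le [CompactSpace M] [LocallyCompactSpace M]
    [Fact (1 ≤ n)] (hn : 2 ≤ n) (hg : g.IsRiemannian) (hcov : g.IsLeviCivita cov) :
    ∃ C : ℝ, 0 ≤ C ∧ ∀ x : M, |g.trace x (cov.ricci x)| ≤ C := by
  obtain ⟨C, hC0, hC⟩ := exists_abs_ricci_frame_le_of_two_le (ι := Fin (Module.finrank ℝ E))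
    hn hg hcov (Fintype.card_fin _)
  refine ⟨Module.finrank ℝ E * C, by positivity, fun x ↦ ?_⟩
  obtain ⟨b, hb⟩ := g.exists_basis_isOrthonormalFrame (x := x) (fun v hv ↦ hg x v hv) rfl
  rw [g.trace_eq_sum_of_isOrthonormalFrame b hb (cov.ricci x)]
  calc |∑ i, cov.ricci x (b i) (b i)| ≤ ∑ i, |cov.ricci x (b i) (b i)| :=
        Finset.abs_sum_le_sum_abs _ _
    _ ≤ ∑ _i : Fin (Module.finrank ℝ E), C := Finset.sum_le_sum fun i _ ↦ hC x b hb i i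
    _ = Module.finrank ℝ E * C := by simp [Finset.sum_const, Finset.card_univ]

/-- **The frame Weyl components on orthonormal bases are uniformly bounded on a compact manifold,
`C^n` metric, `n ≥ 2`** (possibly with boundary): for the Levi-Civita connection `g.leviCivita`,
`|W_{ijkl}(x; e)| ≤ C_W` for all `x` and all `g_x`-orthonormal frames `e` of cardinality `dim E`
(`weylFrame` of `WeylEnergy.lean`: `Rm`, `Ric` and `S` terms bounded separately). Applied to the
`C²` compactification `ḡ` of a conformally compact manifold on the compact `X̄`, this is the
boundedness of `|W[ḡ]|` from which `|W[g⁺]|_{g⁺} = ρ²|W[ḡ]|_ḡ → 0` at infinity (Li–Qing–Shi 2017,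
Lemma 1.6; proof of Thm. 1.8, Step 1). [cite: LiQingShi2017, Thm. 1.8 (proof, Step 1, pp. 12–13) and Lemma 1.6] -/
theorem exists_abs_weylFrame_le_of_two_le [CompactSpace M] [LocallyCompactSpace M]
    [Fact (1 ≤ n)] [g.HasLeviCivita] (hn : 2 ≤ n) (hg : g.IsRiemannian)
    (hι : Fintype.card ι = Module.finrank ℝ E) :
    ∃ C : ℝ, 0 ≤ C ∧ ∀ (x : M) (e : ι → TangentSpace I x), g.IsOrthonormalFrame x e →
      ∀ i j k l, |g.weylFrame x e i j k l| ≤ C := by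
  have hcov : g.IsLeviCivita g.leviCivita := g.isLeviCivita_leviCivita_holds
  obtain ⟨C₁, hC₁0, hC₁⟩ := exists_abs_curvatureForm_frame_le_of_two_le (ι := ι) hn hg hcov
  obtain ⟨C₂, hC₂0, hC₂⟩ := exists_abs_ricci_frame_le_of_two_le (ι := ι) hn hg hcov hι
  obtain ⟨C₃, hC₃0, hC₃⟩ := exists_abs_scalarCurvature_le_of_two_le hn hg hcov
  set m : ℝ := (Fintype.card ι : ℝ) with hm
  set c₁ : ℝ := |1 / (m - 2)| with hc₁
  set c₂ : ℝ := |1 / ((m - 1) * (m - 2))| with hc₂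
  refine ⟨C₁ + c₁ * (4 * C₂) + c₂ * (2 * C₃), by positivity, fun x e he i j k l ↦ ?_⟩
  rw [weylFrame_apply]
  have hδ : ∀ a b : ι, |(if a = b then (1 : ℝ) else 0)| ≤ 1 := fun a b ↦ by
    split_ifs <;> simp
  have hδ' : ∀ a b : ι, 0 ≤ |(if a = b then (1 : ℝ) else 0)| := fun a b ↦ abs_nonneg _
  have hRic : ∀ a b, |g.ricci x (e a) (e b)| ≤ C₂ := fun a b ↦ hC₂ x e he a b
  have hS : |g.scalarCurvature x| ≤ C₃ := hC₃ x
  -- the Ricci correction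
  have hT : |g.ricci x (e i) (e l) * (if j = k then 1 else 0) +
      g.ricci x (e j) (e k) * (if i = l then 1 else 0) -
      g.ricci x (e i) (e k) * (if j = l then 1 else 0) -
      g.ricci x (e j) (e l) * (if i = k then 1 else 0)| ≤ 4 * C₂ := by
    have t1 : |g.ricci x (e i) (e l) * (if j = k then 1 else 0)| ≤ C₂ := by
      rw [abs_mul]; nlinarith [hRic i l, hδ j k, hδ' j k, abs_nonneg (g.ricci x (e i) (e l))]
    have t2 : |g.ricci x (e j) (e k) * (if i = l then 1 else 0)| ≤ C₂ := by
      rw [abs_mul]; nlinarith [hRic j k, hδ i l, hδ' i l, abs_nonneg (g.ricci x (e j) (e k))]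
    have t3 : |g.ricci x (e i) (e k) * (if j = l then 1 else 0)| ≤ C₂ := by
      rw [abs_mul]; nlinarith [hRic i k, hδ j l, hδ' j l, abs_nonneg (g.ricci x (e i) (e k))]
    have t4 : |g.ricci x (e j) (e l) * (if i = k then 1 else 0)| ≤ C₂ := by
      rw [abs_mul]; nlinarith [hRic j l, hδ i k, hδ' i k, abs_nonneg (g.ricci x (e j) (e l))]
    calc _ ≤ |g.ricci x (e i) (e l) * (if j = k then 1 else 0)| +
          |g.ricci x (e j) (e k) * (if i = l then 1 else 0)| +
          |g.ricci x (e i) (e k) * (if j = l then 1 else 0)| +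
          |g.ricci x (e j) (e l) * (if i = k then 1 else 0)| := by
            refine (abs_sub _ _).trans ?_
            refine add_le_add ((abs_sub _ _).trans (add_le_add (abs_add_le _ _) le_rfl)) le_rfl
      _ ≤ C₂ + C₂ + C₂ + C₂ := by linarith
      _ = 4 * C₂ := by ring
  -- the scalar correction
  have hU : |(if i = l then (1 : ℝ) else 0) * (if j = k then 1 else 0) -
      (if i = k then 1 else 0) * (if j = l then 1 else 0)| ≤ 2 := by
    have u1 : |(if i = l then (1 : ℝ) else 0) * (if j = k then 1 else 0)| ≤ 1 := by
      rw [abs_mul]; nlinarith [hδ i l, hδ j k, hδ' i l, hδ' j k]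
    have u2 : |(if i = k then (1 : ℝ) else 0) * (if j = l then 1 else 0)| ≤ 1 := by
      rw [abs_mul]; nlinarith [hδ i k, hδ j l, hδ' i k, hδ' j l]
    calc _ ≤ |(if i = l then (1 : ℝ) else 0) * (if j = k then 1 else 0)| +
          |(if i = k then (1 : ℝ) else 0) * (if j = l then 1 else 0)| := abs_sub _ _
      _ ≤ 2 := by linarith
  have hA : |g.curvatureForm g.leviCivita x (e i) (e j) (e k) (e l)| ≤ C₁ := hC₁ x e he i j k l
  have hB : |1 / ((Fintype.card ι : ℝ) - 2) *
      (g.ricci x (e i) (e l) * (if j = k then 1 else 0) +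
        g.ricci x (e j) (e k) * (if i = l then 1 else 0) -
        g.ricci x (e i) (e k) * (if j = l then 1 else 0) -
        g.ricci x (e j) (e l) * (if i = k then 1 else 0))| ≤ c₁ * (4 * C₂) := by
    rw [abs_mul, ← hm, ← hc₁]
    exact mul_le_mul_of_nonneg_left hT (abs_nonneg _)
  have hC : |g.scalarCurvature x / (((Fintype.card ι : ℝ) - 1) * ((Fintype.card ι : ℝ) - 2)) *
      ((if i = l then (1 : ℝ) else 0) * (if j = k then 1 else 0) -
        (if i = k then 1 else 0) * (if j = l then 1 else 0))| ≤ c₂ * (2 * C₃) := by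
    rw [abs_mul, ← hm, div_eq_mul_one_div, abs_mul, ← hc₂]
    calc |g.scalarCurvature x| * c₂ * |(if i = l then (1 : ℝ) else 0) * (if j = k then 1 else 0) -
          (if i = k then 1 else 0) * (if j = l then 1 else 0)|
        ≤ C₃ * c₂ * 2 := by
          apply mul_le_mul (mul_le_mul_of_nonneg_right hS (abs_nonneg _)) hU (abs_nonneg _)
          positivity
      _ = c₂ * (2 * C₃) := by ring
  calc _ ≤ |g.curvatureForm g.leviCivita x (e i) (e j) (e k) (e l) -
        1 / ((Fintype.card ι : ℝ) - 2) *
          (g.ricci x (e i) (e l) * (if j = k then 1 else 0) +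
            g.ricci x (e j) (e k) * (if i = l then 1 else 0) -
            g.ricci x (e i) (e k) * (if j = l then 1 else 0) -
            g.ricci x (e j) (e l) * (if i = k then 1 else 0))| +
        |g.scalarCurvature x / (((Fintype.card ι : ℝ) - 1) * ((Fintype.card ι : ℝ) - 2)) *
          ((if i = l then (1 : ℝ) else 0) * (if j = k then 1 else 0) -
            (if i = k then 1 else 0) * (if j = l then 1 else 0))| := abs_add_le _ _
    _ ≤ (C₁ + c₁ * (4 * C₂)) + c₂ * (2 * C₃) :=
        add_le_add ((abs_sub _ _).trans (add_le_add hA hB)) hC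
    _ = C₁ + c₁ * (4 * C₂) + c₂ * (2 * C₃) := by ring

end Functional

end Literature.Geometry.Riemannian
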